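import Summits.RiemannHypothesis.RiemannHypothesis.Theorems.WeilTwoPrimeDeflM80PDef
import Summits.RiemannHypothesis.RiemannHypothesis.Theorems.WeilTwoPrimeDeflM80FKappa
import Summits.RiemannHypothesis.RiemannHypothesis.Theorems.WeilTwoPrimeDeflM80FCert2
import HarnessLib

/-!
# Even-sector deflated two-prime certificate M80P: `κ`, `β₂₃ ≤ κ`, `κ − β₂₃ = κ'`, the scalar side conditions and the moment check — by transfer from certificate M80F

`WeilCert23.kappaQ`, `checkScalars` and `checkNu` read only `(a₀, N, T, wL, pg, pnu, j, b, cells, nuData)`, which `weilCertDeflM80P` shares with `weilCertDeflM80F` (same literals, same table by name), so the landed kernel facts of certificate M80F transfer by definitional unfolding (no kernel evaluation here). Pure proof file.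
-/

set_option linter.dupNamespace false

noncomputable section

namespace Summit.RiemannHypothesis.RiemannHypothesis.Theorems.EvenWinsBeyondArch

open Literature.NumberTheory.LFunctions

/-- **The value of `κ`** of certificate M80P (= that of certificate M80F, definitionally). [folklore] -/
theorem kappaQ_weilCertDeflM80P : weilCertDeflM80P.kappaQ = weilCertDeflM80FKappaLit :=
  kappaQ_weilCertDeflM80F

/-- `β₂₃ ≤ κ` for certificate M80P. [folklore] -/
theorem beta_le_kappaQ_weilCertDeflM80P : weilCertDeflM80PBeta ≤ weilCertDeflM80P.kappaQ := by
  rw [kappaQ_weilCertDeflM80P]; unfold weilCertDeflM80PBeta weilCertDeflM80FKappaLit; norm_num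

/-- `κ − β₂₃ = κ'` for certificate M80P. [folklore] -/
theorem kappaQ_sub_beta_weilCertDeflM80P : weilCertDeflM80P.kappaQ - weilCertDeflM80PBeta = weilCertDeflM80PKappa' := by
  rw [kappaQ_weilCertDeflM80P]; unfold weilCertDeflM80PBeta weilCertDeflM80FKappaLit weilCertDeflM80PKappa'; norm_num

/-- **The scalar side conditions** of certificate M80P (transferred from certificate M80F). [folklore] -/
theorem checkScalars_weilCertDeflM80P : weilCertDeflM80P.checkScalars = true :=
  checkScalars_weilCertDeflM80F

/-- **The moment table of certificate M80P is correct** (it is the checked table of certificate M80F). [folklore] -/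
theorem checkNu_weilCertDeflM80P : weilCertDeflM80P.checkNu = true :=
  checkNu_weilCertDeflM80F

end Summit.RiemannHypothesis.RiemannHypothesis.Theorems.EvenWinsBeyondArch
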